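import Mathlib.Analysis.Calculus.MeanValue
import Mathlib.Analysis.Calculus.Deriv.Shift
import Mathlib.Analysis.Calculus.ContDiff.Deriv
import Mathlib.Analysis.InnerProductSpace.PiL2
import Literature.Geometry.Lorentzian.Basic
import HarnessLib

/-!
# Far-cone retardation remainder, VIa: kinematics of a worldline against its tangent

Support file for the brick `SoftEraTubeLift.FarConeRetardationRemainder` (crux H′,
stmt-FinalStateConjecture-17402; card `soft-era-tube-lift`).  For a `C²` worldline `ξ` with speed
`≤ v` and acceleration `≤ A`: the deviation `η(s) = ξ(t₀ − s) − ξ(t₀) + s ξ̇(t₀)` from the tangent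
has `‖η′(s)‖ ≤ A|s|`, `‖η(s)‖ ≤ A s²` (`norm_deriv_deviation_le`, `norm_deviation_le`), and every
interpolated centre curve `c_λ(s) = ξ(t₀) − s ξ̇(t₀) + λη(s)`, `λ ∈ [0, 1]`, is `C²`, passes
through `ξ(t₀)` at `s = 0`, has speed `≤ v` and acceleration `≤ A` (`interp_props`).  Mathlib only.
[folklore]
-/

noncomputable section

open Set Filter Topology Literature.Geometry.Lorentzian

-- the doubled `FinalStateConjecture` path component is the summit/problem naming scheme
set_option linter.dupNamespace false

namespace Summit.FinalStateConjecture.FinalStateConjecture.Theorems.EIHFluxBalance.ModulatedKerrHandoffBricks.FarCone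

/-! ### Kinematics of the deviation `η` and of the interpolated centre curves -/

section Kinematics

variable {ξ : ℝ → E3} {t₀ v A : ℝ}

/-- Derivative of the deviation `η(s) = ξ(t₀ − s) − ξ(t₀) + s ξ̇(t₀)`. [folklore] -/
theorem hasDerivAt_deviation (hξ : Differentiable ℝ ξ) (s : ℝ) :
    HasDerivAt (fun s ↦ ξ (t₀ - s) - ξ t₀ + s • deriv ξ t₀) (-deriv ξ (t₀ - s) + deriv ξ t₀) s := by
  have h1 : HasDerivAt (fun s ↦ ξ (t₀ - s)) (-deriv ξ (t₀ - s)) s :=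
    HasDerivAt.comp_const_sub t₀ s (hξ _).hasDerivAt
  have h2 := (h1.sub_const (ξ t₀)).fun_add ((hasDerivAt_id' s).smul_const (deriv ξ t₀))
  exact h2.congr_deriv (by rw [one_smul])

/-- `η′(s) = −ξ̇(t₀ − s) + ξ̇(t₀)`. [folklore] -/
theorem deriv_deviation (hξ : Differentiable ℝ ξ) :
    deriv (fun s ↦ ξ (t₀ - s) - ξ t₀ + s • deriv ξ t₀) = fun s ↦ -deriv ξ (t₀ - s) + deriv ξ t₀ :=
  funext fun s ↦ (hasDerivAt_deviation hξ s).deriv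

/-- `ξ ∈ C²` has a differentiable derivative. [folklore] -/
theorem differentiable_deriv_of_contDiff_two (hξ : ContDiff ℝ 2 ξ) : Differentiable ℝ (deriv ξ) :=
  (contDiff_succ_iff_deriv.1 (show ContDiff ℝ (1 + 1) ξ by rw [one_add_one_eq_two]; exact hξ)).2.2
    |>.differentiable one_ne_zero

/-- `η″(s) = ξ̈(t₀ − s)`. [folklore] -/
theorem hasDerivAt_deriv_deviation (hξ : ContDiff ℝ 2 ξ) (s : ℝ) :
    HasDerivAt (fun s ↦ -deriv ξ (t₀ - s) + deriv ξ t₀) (deriv (deriv ξ) (t₀ - s)) s := by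
  have hd := differentiable_deriv_of_contDiff_two hξ
  have h1 : HasDerivAt (fun s ↦ deriv ξ (t₀ - s)) (-deriv (deriv ξ) (t₀ - s)) s :=
    HasDerivAt.comp_const_sub t₀ s (hd _).hasDerivAt
  exact (h1.fun_neg.add_const (deriv ξ t₀)).congr_deriv (by rw [neg_neg])

/-- **`‖η′(s)‖ ≤ A|s|`** (mean value from `η′(0) = 0`, `‖η″‖ ≤ A`). [folklore] -/
theorem norm_deriv_deviation_le (hξ : ContDiff ℝ 2 ξ) (hA : ∀ t, ‖deriv (deriv ξ) t‖ ≤ A) (s : ℝ) :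
    ‖deriv (fun s ↦ ξ (t₀ - s) - ξ t₀ + s • deriv ξ t₀) s‖ ≤ A * |s| := by
  rw [deriv_deviation (hξ.differentiable two_ne_zero)]
  have h := Convex.norm_image_sub_le_of_norm_hasDerivWithin_le
    (f := fun s ↦ -deriv ξ (t₀ - s) + deriv ξ t₀) (s := univ) (C := A)
    (fun τ _ ↦ (hasDerivAt_deriv_deviation hξ τ).hasDerivWithinAt) (fun τ _ ↦ hA _) convex_univ
    (mem_univ 0) (mem_univ s)
  simp only [sub_zero, neg_add_cancel, Real.norm_eq_abs] at h
  simpa using h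

/-- On the segment `[0, s]`, `|τ| ≤ |s|`. [folklore] -/
theorem abs_le_abs_of_mem_uIcc_zero {τ s : ℝ} (h : τ ∈ uIcc 0 s) : |τ| ≤ |s| := by
  rcases le_total 0 s with hs | hs
  · rw [uIcc_of_le hs] at h; rw [abs_of_nonneg h.1, abs_of_nonneg hs]; exact h.2
  · rw [uIcc_of_ge hs] at h; rw [abs_of_nonpos h.2, abs_of_nonpos hs]; linarith [h.1]

/-- **`‖η(s)‖ ≤ A s²`** (mean value again, `η(0) = 0`). [folklore] -/
theorem norm_deviation_le (hξ : ContDiff ℝ 2 ξ) (hA : ∀ t, ‖deriv (deriv ξ) t‖ ≤ A) (s : ℝ) :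
    ‖ξ (t₀ - s) - ξ t₀ + s • deriv ξ t₀‖ ≤ A * s ^ 2 := by
  have hξd := hξ.differentiable two_ne_zero
  have hbound : ∀ τ ∈ uIcc 0 s, ‖-deriv ξ (t₀ - τ) + deriv ξ t₀‖ ≤ A * |s| := by
    intro τ hτ
    calc ‖-deriv ξ (t₀ - τ) + deriv ξ t₀‖
        = ‖deriv (fun s ↦ ξ (t₀ - s) - ξ t₀ + s • deriv ξ t₀) τ‖ := by rw [deriv_deviation hξd]
      _ ≤ A * |τ| := norm_deriv_deviation_le hξ hA τ
      _ ≤ A * |s| := mul_le_mul_of_nonneg_left (abs_le_abs_of_mem_uIcc_zero hτ)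
          ((norm_nonneg _).trans (hA 0))
  have h := Convex.norm_image_sub_le_of_norm_hasDerivWithin_le
    (f := fun s ↦ ξ (t₀ - s) - ξ t₀ + s • deriv ξ t₀) (s := uIcc 0 s) (C := A * |s|)
    (fun τ _ ↦ (hasDerivAt_deviation hξd τ).hasDerivWithinAt) hbound (convex_uIcc 0 s)
    left_mem_uIcc right_mem_uIcc
  simp only [sub_zero, sub_self, zero_smul, add_zero, Real.norm_eq_abs] at h
  calc ‖ξ (t₀ - s) - ξ t₀ + s • deriv ξ t₀‖ ≤ A * |s| * |s| := h
    _ = A * s ^ 2 := by rw [mul_assoc, ← sq, sq_abs]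

end Kinematics

/-! ### The interpolated centre curves `c_λ = c₀ + λη` -/

section Curves

variable {ξ : ℝ → E3} {t₀ v A : ℝ}

/-- Derivative of `c_λ(s) = ξ₀ − s v₀ + λ η(s)`: `c_λ′(s) = −(1 − λ)v₀ − λ ξ̇(t₀ − s)`. [folklore] -/
theorem hasDerivAt_interp (hξ : Differentiable ℝ ξ) (lam s : ℝ) :
    HasDerivAt (fun s ↦ ξ t₀ - s • deriv ξ t₀ + lam • (ξ (t₀ - s) - ξ t₀ + s • deriv ξ t₀))
      (-(1 - lam) • deriv ξ t₀ - lam • deriv ξ (t₀ - s)) s := by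
  have h := (((hasDerivAt_id' s).smul_const (deriv ξ t₀)).const_sub (ξ t₀)).fun_add
    ((hasDerivAt_deviation (t₀ := t₀) hξ s).fun_const_smul lam)
  refine h.congr_deriv ?_
  simp only [one_smul, smul_add, smul_neg, sub_smul, neg_sub]
  abel

/-- `c_λ′ = …` as a function. [folklore] -/
theorem deriv_interp (hξ : Differentiable ℝ ξ) (lam : ℝ) :
    deriv (fun s ↦ ξ t₀ - s • deriv ξ t₀ + lam • (ξ (t₀ - s) - ξ t₀ + s • deriv ξ t₀)) =
      fun s ↦ -(1 - lam) • deriv ξ t₀ - lam • deriv ξ (t₀ - s) :=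
  funext fun s ↦ (hasDerivAt_interp hξ lam s).deriv

/-- `c_λ″(s) = λ ξ̈(t₀ − s)`. [folklore] -/
theorem hasDerivAt_deriv_interp (hξ : ContDiff ℝ 2 ξ) (lam s : ℝ) :
    HasDerivAt (fun s ↦ -(1 - lam) • deriv ξ t₀ - lam • deriv ξ (t₀ - s))
      (lam • deriv (deriv ξ) (t₀ - s)) s := by
  have hd := differentiable_deriv_of_contDiff_two hξ
  have h1 : HasDerivAt (fun s ↦ deriv ξ (t₀ - s)) (-deriv (deriv ξ) (t₀ - s)) s :=
    HasDerivAt.comp_const_sub t₀ s (hd _).hasDerivAt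
  exact ((h1.fun_const_smul lam).const_sub (-(1 - lam) • deriv ξ t₀)).congr_deriv (by simp)

/-- **The interpolated curves are centre curves**: `C²`, through `ξ₀` at `s = 0`, speed `≤ v`,
acceleration `≤ A`, for `λ ∈ [0, 1]`. [folklore] -/
theorem interp_props (hξ : ContDiff ℝ 2 ξ) (hv : ∀ t, ‖deriv ξ t‖ ≤ v)
    (hA : ∀ t, ‖deriv (deriv ξ) t‖ ≤ A) {lam : ℝ} (h0 : 0 ≤ lam) (h1 : lam ≤ 1) :
    ContDiff ℝ 2 (fun s ↦ ξ t₀ - s • deriv ξ t₀ + lam • (ξ (t₀ - s) - ξ t₀ + s • deriv ξ t₀)) ∧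
    (fun s ↦ ξ t₀ - s • deriv ξ t₀ + lam • (ξ (t₀ - s) - ξ t₀ + s • deriv ξ t₀)) 0 = ξ t₀ ∧
    (∀ s, ‖deriv (fun s ↦ ξ t₀ - s • deriv ξ t₀ + lam • (ξ (t₀ - s) - ξ t₀ + s • deriv ξ t₀)) s‖
      ≤ v) ∧
    (∀ s, ‖deriv (deriv (fun s ↦ ξ t₀ - s • deriv ξ t₀ +
      lam • (ξ (t₀ - s) - ξ t₀ + s • deriv ξ t₀))) s‖ ≤ A) := by
  have hξd := hξ.differentiable two_ne_zero
  refine ⟨?_, by simp, fun s ↦ ?_, fun s ↦ ?_⟩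
  · have hc : ContDiff ℝ 2 fun s : ℝ ↦ ξ (t₀ - s) := hξ.comp (contDiff_const.sub contDiff_id)
    exact (contDiff_const.sub (contDiff_id.smul contDiff_const)).add
      (ContDiff.const_smul lam ((hc.sub contDiff_const).add (contDiff_id.smul contDiff_const)))
  · rw [deriv_interp hξd]
    calc ‖-(1 - lam) • deriv ξ t₀ - lam • deriv ξ (t₀ - s)‖
        ≤ ‖-(1 - lam) • deriv ξ t₀‖ + ‖lam • deriv ξ (t₀ - s)‖ := norm_sub_le _ _
      _ ≤ (1 - lam) * v + lam * v := by
          rw [norm_smul, norm_smul, norm_neg, Real.norm_eq_abs, Real.norm_eq_abs,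
            abs_of_nonneg (by linarith), abs_of_nonneg h0]
          exact add_le_add (mul_le_mul_of_nonneg_left (hv _) (by linarith))
            (mul_le_mul_of_nonneg_left (hv _) h0)
      _ = v := by ring
  · rw [deriv_interp hξd, (hasDerivAt_deriv_interp hξ lam s).deriv, norm_smul, Real.norm_eq_abs,
      abs_of_nonneg h0]
    calc lam * ‖deriv (deriv ξ) (t₀ - s)‖ ≤ 1 * A :=
          mul_le_mul h1 (hA _) (norm_nonneg _) zero_le_one
      _ = A := one_mul A

end Curves

/-! ### Registered form -/

/-- **Interpolated centre curves are centre curves** (registered helper of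
stmt-FinalStateConjecture-17402, brick `FarConeRetardationRemainder`). [folklore] -/
theorem farCone_interp_props : ∀ (ξ : ℝ → EuclideanSpace ℝ (Fin 3)) (t₀ v A lam : ℝ), ContDiff ℝ 2 ξ → (∀ t, ‖deriv ξ t‖ ≤ v) → (∀ t, ‖deriv (deriv ξ) t‖ ≤ A) → 0 ≤ lam → lam ≤ 1 → ContDiff ℝ 2 (fun s ↦ ξ t₀ - s • deriv ξ t₀ + lam • (ξ (t₀ - s) - ξ t₀ + s • deriv ξ t₀)) ∧ (fun s ↦ ξ t₀ - s • deriv ξ t₀ + lam • (ξ (t₀ - s) - ξ t₀ + s • deriv ξ t₀)) 0 = ξ t₀ ∧ (∀ s, ‖deriv (fun s ↦ ξ t₀ - s • deriv ξ t₀ + lam • (ξ (t₀ - s) - ξ t₀ + s • deriv ξ t₀)) s‖ ≤ v) ∧ (∀ s, ‖deriv (deriv (fun s ↦ ξ t₀ - s • deriv ξ t₀ + lam • (ξ (t₀ - s) - ξ t₀ + s • deriv ξ t₀))) s‖ ≤ A) :=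
  fun _ξ _t₀ _v _A _lam hξ hv hA h0 h1 ↦ interp_props hξ hv hA h0 h1

end Summit.FinalStateConjecture.FinalStateConjecture.Theorems.EIHFluxBalance.ModulatedKerrHandoffBricks.FarCone

end
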